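import Summits.AtomisticToContinuum.HydrodynamicLimit.Theorems.RelayRaceLocalityNearConstantShortTimeHLFluxIntegrabilityB
import Summits.AtomisticToContinuum.HydrodynamicLimit.Theorems.RelayRaceLocalityNearConstantShortTimeHLOrbitIntegrability
import Summits.AtomisticToContinuum.HydrodynamicLimit.Theorems.RelayRaceLocalityNearConstantShortTimeHLDerivContinuity
import HarnessLib

/-!
# Crux `NearConstantShortTimeHL` (stmt-AtomisticToContinuum-12502), line `small-tilt-domination` — elementary tools for the energy-weighted fluctuation functional

Support file for the crux `…Theses.RelayRaceLocality.NearConstantShortTimeHL`, line `small-tilt-domination`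
(lead c4, Grönwall assembly `stub_gronwallAssembly`): the four registered stubs

* `fluctuationE_le` — the crude bound `fluctuationE ℓ ρ₁ θ₁ u₁ w ≤ 2 + K(w)` for `n ≥ 1` particles and
  `0 < ℓ < 1/2` (`K = n⁻¹ Σ ‖vᵢ‖²/2`): the cap `min 1 (dev²) ≤ 1`, the unit volume of `𝕋³`, and the exact
  totals `∫ ρ̃ dx = 1`, `∫ ẽ dx = K` of the ball averages (`integral_empiricalDensityField_ballKernel`,
  `integral_empiricalEnergyField_ballKernel`);
* `measurable_kineticPP_cubicTail` — `K` and the cubic velocity tail `n⁻¹ Σ ‖vᵢ‖³ 𝟙{‖vᵢ‖ > L}` are measurable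
  and nonnegative functions of the configuration (finite sums of continuous / indicator∘continuous coordinates);
* `measurable_fluctuationE_clamp` — joint measurability of `(r, w) ↦ fluctuationE ℓ (ρ_{r'}) (θ_{r'}) (u_{r'}) w`,
  `r' = clamp_{[0,t]} r`, for a classical hard-sphere Euler solution on `[0, T)`, `t < T`: the integrand is jointly
  measurable in `((r, w), x)` (ball fields measurable in `(x, w)` — `wg_measurable_ball*`; Euler fields continuous in
  `(r, x)` after clamping — `continuousOn_derivs_of_isSmoothSpaceTimeOn`), and the Bochner integral of a jointly
  measurable integrand is measurable in the parameter (`StronglyMeasurable.integral_prod_right`);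
* `intervalIntegrable_fluctuationE_cubicTail_orbit` — along a good hard-sphere orbit and on `[a, b] ⊆ [0, t]`, both
  `r ↦ fluctuationE ℓ (ρ_r) (θ_r) (u_r) (Φ_r z)` and `r ↦ cubicTail L (Φ_r z)` are interval integrable: measurable
  in `r` (the previous item composed with the measurable orbit `wf_measurable_flow`) and bounded uniformly in `r`
  by the kernel height `|V_ℓ⁻¹|` and the conserved speed bound `√(2E(z))` (`wg_norm_vel_flow_le`), hence
  `wg_intervalIntegrable_of_bound`.

No definitions, no named facts. References: H.-T. Yau, Lett. Math. Phys. 22 (1991) §2 (the relative-entropy method;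
these are its bookkeeping facts); R. K. Alexander, PhD thesis (1975) Ch. 2 (measurability of the hard-sphere flow).
-/

noncomputable section

namespace Summit.AtomisticToContinuum.HydrodynamicLimit.Theorems.NearConstantShortTimeHL

open scoped BigOperators ENNReal Topology
open MeasureTheory Set Filter
open Literature.MathematicalPhysics.KineticTheory Literature.Analysis.FluidPDE Literature.Analysis.FunctionSpaces

/-! ## Pointwise bounds -/

/-- The ball-averaged density is bounded by the kernel height `|V_ℓ⁻¹|`, `V_ℓ = (4/3)πℓ³` (any `ℓ`, any particle
number). [folklore] -/
theorem xu_ballDensity_le_height {n : ℕ} (ℓ : ℝ) (x : T3) (w : Config n (Fin 3) T3) :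
    empiricalDensityField w (ballKernel ℓ x) ≤ |(4 / 3 * Real.pi * ℓ ^ 3)⁻¹| := by
  rw [empiricalDensityField_eq_sum]
  exact wg_avg_le (fun i => wg_ballKernel_le ℓ x (w i).1) (abs_nonneg _)

/-- The integrand of `fluctuationE` is nonnegative and at most its weight `1 + ρ̃ + ẽ` (the cap `min 1 · ≤ 1`).
[folklore] -/
theorem xu_fluctuationE_integrand_le {n : ℕ} (ℓ : ℝ) (ρ₁ θ₁ : T3 → ℝ) (u₁ : T3 → V3) (w : Config n (Fin 3) T3)
    (x : T3) :
    0 ≤ (1 + empiricalDensityField w (ballKernel ℓ x) + empiricalEnergyField w (ballKernel ℓ x)) *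
        min 1 ((empiricalDensityField w (ballKernel ℓ x) - ρ₁ x) ^ 2 +
          ‖empiricalMomentumField w (ballKernel ℓ x) - ρ₁ x • u₁ x‖ ^ 2 +
          (empiricalEnergyField w (ballKernel ℓ x) - totalEnergyDensity (ρ₁ x) (u₁ x) (θ₁ x)) ^ 2) ∧
    (1 + empiricalDensityField w (ballKernel ℓ x) + empiricalEnergyField w (ballKernel ℓ x)) *
        min 1 ((empiricalDensityField w (ballKernel ℓ x) - ρ₁ x) ^ 2 +
          ‖empiricalMomentumField w (ballKernel ℓ x) - ρ₁ x • u₁ x‖ ^ 2 +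
          (empiricalEnergyField w (ballKernel ℓ x) - totalEnergyDensity (ρ₁ x) (u₁ x) (θ₁ x)) ^ 2) ≤
      1 + empiricalDensityField w (ballKernel ℓ x) + empiricalEnergyField w (ballKernel ℓ x) := by
  have h0 : 0 ≤ 1 + empiricalDensityField w (ballKernel ℓ x) + empiricalEnergyField w (ballKernel ℓ x) := by
    linarith [ballDensity_nonneg ℓ x w, ballEnergy_nonneg ℓ x w]
  refine ⟨mul_nonneg h0 (le_min zero_le_one (by positivity)), ?_⟩
  calc _ ≤ (1 + empiricalDensityField w (ballKernel ℓ x) + empiricalEnergyField w (ballKernel ℓ x)) * 1 :=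
        mul_le_mul_of_nonneg_left (min_le_left _ _) h0
    _ = _ := mul_one _

/-- **Crude bound under a speed cap.** If all speeds of `w` are `≤ V` then, for ANY radius `ℓ` and any fields,
`|fluctuationE ℓ ρ₁ θ₁ u₁ w| ≤ 1 + |V_ℓ⁻¹| + |V_ℓ⁻¹| V²/2` (`ρ̃ ≤ |V_ℓ⁻¹|`, `ẽ ≤ |V_ℓ⁻¹| V²/2`, unit volume of `𝕋³`).
[folklore] -/
theorem xu_abs_fluctuationE_le_of_speed {n : ℕ} (ℓ : ℝ) (ρ₁ θ₁ : T3 → ℝ) (u₁ : T3 → V3) (w : Config n (Fin 3) T3)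
    {V : ℝ} (hV : ∀ i, ‖(w i).2‖ ≤ V) :
    |fluctuationE ℓ ρ₁ θ₁ u₁ w| ≤
      1 + |(4 / 3 * Real.pi * ℓ ^ 3)⁻¹| + |(4 / 3 * Real.pi * ℓ ^ 3)⁻¹| * (V ^ 2 / 2) := by
  unfold fluctuationE
  refine EntropicWeakStrong.abs_integral_le_of_abs_le fun x => ?_
  obtain ⟨h0, h1⟩ := xu_fluctuationE_integrand_le ℓ ρ₁ θ₁ u₁ w x
  rw [abs_of_nonneg h0]
  refine h1.trans ?_
  linarith [xu_ballDensity_le_height ℓ x w, wg_ballEnergy_le ℓ x w hV]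

/-- The cubic velocity tail is dominated by the cube of a speed cap: `‖vᵢ‖ ≤ V` for all `i` (`V ≥ 0`) gives
`|cubicTail L w| ≤ V³`. [folklore] -/
theorem xu_abs_cubicTail_le_of_speed {n : ℕ} (L : ℝ) (w : Config n (Fin 3) T3) {V : ℝ} (hV0 : 0 ≤ V)
    (hV : ∀ i, ‖(w i).2‖ ≤ V) : |cubicTail L w| ≤ V ^ 3 := by
  have hnn : ∀ i, 0 ≤ Set.indicator {v : V3 | L < ‖v‖} (fun v => ‖v‖ ^ 3) (w i).2 := fun i =>
    Set.indicator_nonneg (fun v _ => by positivity) _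
  unfold cubicTail
  rw [abs_of_nonneg (mul_nonneg (inv_nonneg.2 (Nat.cast_nonneg n)) (Finset.sum_nonneg fun i _ => hnn i))]
  refine wg_avg_le (fun i => ?_) (by positivity)
  exact Set.indicator_apply_le' (fun _ => pow_le_pow_left₀ (norm_nonneg _) (hV i) 3) fun _ => by positivity

/-! ## Measurability tools -/

/-- The total energy density `E(ρ, u, θ) = ρ(‖u‖²/2 + 3θ/2)` at measurable arguments is measurable. [folklore] -/
theorem xu_measurable_totalEnergyDensity {α : Type*} [MeasurableSpace α] {R Θ : α → ℝ} {U : α → V3}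
    (hR : Measurable R) (hU : Measurable U) (hΘ : Measurable Θ) :
    Measurable fun a => totalEnergyDensity (R a) (U a) (Θ a) := by
  unfold totalEnergyDensity
  exact hR.mul (((hU.norm.pow_const 2).div_const 2).add (measurable_const.mul hΘ))

/-- **The integrand of `fluctuationE` at measurable arguments is measurable**: if the three ball fields `D, M, E`
and the three hydrodynamic fields `R, U, Θ` are measurable functions on a measurable space, so is
`(1 + D + E) · min 1 ((D − R)² + ‖M − R U‖² + (E − E(R, U, Θ))²)`. [folklore] -/
theorem xu_measurable_integrand {α : Type*} [MeasurableSpace α] {D E R Θ : α → ℝ} {M U : α → V3}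
    (hD : Measurable D) (hM : Measurable M) (hE : Measurable E) (hR : Measurable R) (hU : Measurable U)
    (hΘ : Measurable Θ) :
    Measurable fun a => (1 + D a + E a) *
      min 1 ((D a - R a) ^ 2 + ‖M a - R a • U a‖ ^ 2 + (E a - totalEnergyDensity (R a) (U a) (Θ a)) ^ 2) := by
  have hT := xu_measurable_totalEnergyDensity hR hU hΘ
  exact ((measurable_const.add hD).add hE).mul (measurable_const.min
    ((((hD.sub hR).pow_const 2).add ((hM.sub (hR.smul hU)).norm.pow_const 2)).add ((hE.sub hT).pow_const 2)))

/-- **Clamped Euler fields are jointly continuous.** For a field `f` jointly smooth on `[0, T) × 𝕋³` and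
`0 ≤ t < T`, `(r, x) ↦ f (max 0 (min r t)) x` is continuous on `ℝ × 𝕋³` (joint continuity on the slab
`[0, t] × 𝕋³`, `continuousOn_derivs_of_isSmoothSpaceTimeOn`, composed with the continuous clamp into the slab).
[folklore] -/
theorem xu_continuous_clamp_field {F' : Type*} [NormedAddCommGroup F'] [NormedSpace ℝ F'] {T t : ℝ}
    {f : ℝ → T3 → F'} (hf : Torus.IsSmoothSpaceTimeOn (Set.Ico 0 T) f) (ht0 : 0 ≤ t) (htT : t < T) :
    Continuous fun p : ℝ × T3 => f (max 0 (min p.1 t)) p.2 := by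
  have hc := (continuousOn_derivs_of_isSmoothSpaceTimeOn hf htT).1
  have hcl : Continuous fun p : ℝ × T3 => (max 0 (min p.1 t), p.2) :=
    (continuous_const.max (continuous_fst.min continuous_const)).prodMk continuous_snd
  have hmem : ∀ p : ℝ × T3, (max 0 (min p.1 t), p.2) ∈ Set.Icc 0 t ×ˢ (Set.univ : Set T3) := fun p =>
    Set.mk_mem_prod ⟨le_max_left _ _, max_le ht0 (min_le_right _ _)⟩ (Set.mem_univ _)
  exact hc.comp_continuous hcl hmem

/-- A clamped Euler field, read at the time coordinate and the space variable of a point of `(ℝ × Config) × 𝕋³`,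
is measurable there. [folklore] -/
theorem xu_measurable_clamp_field {F' : Type*} [NormedAddCommGroup F'] [NormedSpace ℝ F'] [MeasurableSpace F']
    [BorelSpace F'] {T t : ℝ} {f : ℝ → T3 → F'} (hf : Torus.IsSmoothSpaceTimeOn (Set.Ico 0 T) f) (ht0 : 0 ≤ t)
    (htT : t < T) (n : ℕ) :
    Measurable fun q : (ℝ × Config n (Fin 3) T3) × T3 => f (max 0 (min q.1.1 t)) q.2 :=
  (xu_continuous_clamp_field hf ht0 htT).measurable.comp (measurable_fst.fst.prodMk measurable_snd)

/-! ## The registered stubs -/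

/-- **Registered stub `fluctuationE_le`.** For `n ≥ 1` particles and `0 < ℓ < 1/2`:
`fluctuationE ℓ ρ₁ θ₁ u₁ w ≤ 2 + K(w)` — the cap gives integrand `≤ 1 + ρ̃ + ẽ`, and `∫ 1 = 1`, `∫ ρ̃ = 1`, `∫ ẽ = K`
(unit mass of the ball kernel). [cite: Yau1991, §2] -/
theorem fluctuationE_le : ∀ {n : ℕ}, n ≠ 0 → ∀ {ℓ : ℝ}, 0 < ℓ → ℓ < 1 / 2 → ∀ (ρ₁ θ₁ : T3 → ℝ) (u₁ : T3 → V3) (w : Config n (Fin 3) T3), fluctuationE ℓ ρ₁ θ₁ u₁ w ≤ 2 + kineticPP w := by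
  intro n hn ℓ hℓ0 hℓ ρ₁ θ₁ u₁ w
  have hD : Integrable fun x => empiricalDensityField w (ballKernel ℓ x) := by
    simpa only [one_mul] using integrable_mul_ballDensity ℓ (continuous_const (y := (1 : ℝ))) w
  have hE : Integrable fun x => empiricalEnergyField w (ballKernel ℓ x) := by
    simpa only [one_mul] using integrable_mul_ballEnergy ℓ (continuous_const (y := (1 : ℝ))) w
  have h1 : ∫ x, empiricalDensityField w (ballKernel ℓ x) = 1 :=
    integral_empiricalDensityField_ballKernel hn hℓ0 hℓ w
  have h2 : ∫ x, empiricalEnergyField w (ballKernel ℓ x) = kineticPP w :=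
    integral_empiricalEnergyField_ballKernel hℓ0 hℓ w
  have h3 : ∫ _x : T3, (1 : ℝ) = 1 := by
    rw [integral_const, probReal_univ, one_smul]
  have hI1 : Integrable fun x : T3 => 1 + empiricalDensityField w (ballKernel ℓ x) := (integrable_const 1).add hD
  have hI2 : Integrable fun x : T3 =>
      1 + empiricalDensityField w (ballKernel ℓ x) + empiricalEnergyField w (ballKernel ℓ x) := hI1.add hE
  unfold fluctuationE
  calc _ ≤ ∫ x, (1 + empiricalDensityField w (ballKernel ℓ x) + empiricalEnergyField w (ballKernel ℓ x)) :=
        integral_mono_of_nonneg (ae_of_all _ fun x => (xu_fluctuationE_integrand_le ℓ ρ₁ θ₁ u₁ w x).1) hI2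
          (ae_of_all _ fun x => (xu_fluctuationE_integrand_le ℓ ρ₁ θ₁ u₁ w x).2)
    _ = 2 + kineticPP w := by
        rw [integral_add hI1 hE, integral_add (integrable_const 1) hD, h1, h2, h3]
        ring

/-- **Registered stub `measurable_kineticPP_cubicTail`.** The kinetic energy per particle `K` and the cubic velocity
tail `cubicTail L` are measurable functions of the configuration (finite sums of continuous, resp.
indicator-of-a-measurable-set-times-continuous, functions of one velocity coordinate), and both are nonnegative.
[folklore] -/
theorem measurable_kineticPP_cubicTail : ∀ {n : ℕ} (L : ℝ), Measurable (fun w : Config n (Fin 3) T3 => kineticPP w) ∧ Measurable (fun w : Config n (Fin 3) T3 => cubicTail L w) ∧ ∀ w : Config n (Fin 3) T3, 0 ≤ cubicTail L w ∧ 0 ≤ kineticPP w := by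
  intro n L
  have hv : ∀ i : Fin n, Measurable fun w : Config n (Fin 3) T3 => (w i).2 := fun i => (measurable_pi_apply i).snd
  have hS : MeasurableSet {v : V3 | L < ‖v‖} := measurableSet_lt measurable_const measurable_norm
  have hI : Measurable (Set.indicator {v : V3 | L < ‖v‖} fun v => ‖v‖ ^ 3) :=
    (measurable_norm.pow_const 3).indicator hS
  have hnn : ∀ (w : Config n (Fin 3) T3) (i : Fin n),
      0 ≤ Set.indicator {v : V3 | L < ‖v‖} (fun v => ‖v‖ ^ 3) (w i).2 := fun w i =>
    Set.indicator_nonneg (fun v _ => by positivity) _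
  refine ⟨?_, ?_, fun w => ⟨?_, ?_⟩⟩
  · unfold kineticPP
    exact (Finset.measurable_sum _ fun i _ => ((hv i).norm.pow_const 2).div_const 2).const_mul _
  · unfold cubicTail
    exact (Finset.measurable_sum _ fun i _ => hI.comp (hv i)).const_mul _
  · unfold cubicTail
    exact mul_nonneg (inv_nonneg.2 (Nat.cast_nonneg n)) (Finset.sum_nonneg fun i _ => hnn w i)
  · unfold kineticPP
    exact mul_nonneg (inv_nonneg.2 (Nat.cast_nonneg n)) (Finset.sum_nonneg fun i _ => by positivity)

/-- **Registered stub `measurable_fluctuationE_clamp`.** For a classical hard-sphere Euler solution on `[0, T)` and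
`t ∈ [0, T)`, the map `(r, w) ↦ fluctuationE ℓ (ρ_{r'}) (θ_{r'}) (u_{r'}) w`, `r' = max 0 (min r t)`, is measurable
on `ℝ × Config`: the integrand is jointly measurable in `((r, w), x)` (ball fields measurable in `(x, w)`, clamped
Euler fields continuous in `(r, x)`), so its space integral is measurable in the parameter (Fubini measurability,
`StronglyMeasurable.integral_prod_right`). [cite: Yau1991, §2] -/
theorem measurable_fluctuationE_clamp : ∀ {σ T : ℝ} {ρ θ : ℝ → T3 → ℝ} {u : ℝ → T3 → V3}, IsHardSphereEulerSolution σ T ρ u θ → ∀ {t : ℝ}, t ∈ Set.Ico 0 T → ∀ {n : ℕ} (ℓ : ℝ), Measurable (fun p : ℝ × Config n (Fin 3) T3 => fluctuationE ℓ (ρ (max 0 (min p.1 t))) (θ (max 0 (min p.1 t))) (u (max 0 (min p.1 t))) p.2) := by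
  intro σ T ρ θ u hsol t ht n ℓ
  have hW : Measurable fun q : (ℝ × Config n (Fin 3) T3) × T3 => q.1.2 := measurable_fst.snd
  have hX : Measurable fun q : (ℝ × Config n (Fin 3) T3) × T3 => q.2 := measurable_snd
  have hG := xu_measurable_integrand (wg_measurable_ballDensity hW hX ℓ) (wg_measurable_ballMomentum hW hX ℓ)
    (wg_measurable_ballEnergy hW hX ℓ) (xu_measurable_clamp_field hsol.smooth_density ht.1 ht.2 n)
    (xu_measurable_clamp_field hsol.smooth_velocity ht.1 ht.2 n)
    (xu_measurable_clamp_field hsol.smooth_temperature ht.1 ht.2 n)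
  unfold fluctuationE
  exact (hG.stronglyMeasurable.integral_prod_right' (ν := (volume : Measure T3))).measurable

/-- **Registered stub `intervalIntegrable_fluctuationE_cubicTail_orbit`.** Along the orbit of a good datum of a
hard-sphere flow and on `[a, b] ⊆ [0, t]`, `t < T`, both `r ↦ fluctuationE ℓ (ρ_r) (θ_r) (u_r) (Φ_r z)` and
`r ↦ cubicTail L (Φ_r z)` are interval integrable: measurable in `r` (joint measurability in `(r, w)` composed with the
measurable orbit; on `[a, b]` the clamp is the identity) and bounded uniformly in `r` through the kernel height and the
conserved speed bound `√(2E(z))`. [cite: Yau1991, §2] -/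
theorem intervalIntegrable_fluctuationE_cubicTail_orbit : ∀ {σ T : ℝ} {ρ θ : ℝ → T3 → ℝ} {u : ℝ → T3 → V3}, IsHardSphereEulerSolution σ T ρ u θ → ∀ {t : ℝ}, t ∈ Set.Ico 0 T → ∀ {ε : ℝ} {n : ℕ} (Φ : HardSphereFlow (Torus.geometry (Fin 3)) ε n) {z : Config n (Fin 3) T3}, z ∈ Φ.good → ∀ {a b : ℝ}, 0 ≤ a → a ≤ b → b ≤ t → ∀ (ℓ L : ℝ), IntervalIntegrable (fun r => fluctuationE ℓ (ρ r) (θ r) (u r) (Φ.flow r z)) volume a b ∧ IntervalIntegrable (fun r => cubicTail L (Φ.flow r z)) volume a b := by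
  intro σ T ρ θ u hsol t ht ε n Φ z hz a b ha hab hbt ℓ L
  have hWm : Measurable fun r : ℝ => Φ.flow r z := wf_measurable_flow Φ hz
  have hV0 : 0 ≤ Real.sqrt (2 * configEnergy z) := Real.sqrt_nonneg _
  have hv : ∀ r i, ‖(Φ.flow r z i).2‖ ≤ Real.sqrt (2 * configEnergy z) := wg_norm_vel_flow_le Φ hz
  have hclamp : ∀ r ∈ Set.Icc a b, max 0 (min r t) = r := fun r hr => by
    rw [min_eq_left (hr.2.trans hbt), max_eq_right (ha.trans hr.1)]
  refine ⟨?_, ?_⟩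
  · -- the fluctuation functional: measurable through the clamp, bounded by the crude speed bound
    have hpair : Measurable fun r : ℝ => (r, Φ.flow r z) := measurable_id.prodMk hWm
    have hg : Measurable ((fun p : ℝ × Config n (Fin 3) T3 => fluctuationE ℓ (ρ (max 0 (min p.1 t)))
        (θ (max 0 (min p.1 t))) (u (max 0 (min p.1 t))) p.2) ∘ fun r : ℝ => (r, Φ.flow r z)) :=
      (measurable_fluctuationE_clamp hsol ht ℓ).comp hpair
    refine wg_intervalIntegrable_of_bound hab (hg.aestronglyMeasurable.congr ?_) fun r _ =>
      xu_abs_fluctuationE_le_of_speed ℓ (ρ r) (θ r) (u r) (Φ.flow r z) (hv r)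
    filter_upwards [ae_restrict_mem measurableSet_Icc] with r hr
    show fluctuationE ℓ (ρ (max 0 (min r t))) (θ (max 0 (min r t))) (u (max 0 (min r t))) (Φ.flow r z) = _
    rw [hclamp r hr]
  · -- the cubic tail: measurable in the configuration, bounded by the cube of the speed bound
    have hg : Measurable fun r : ℝ => cubicTail L (Φ.flow r z) := (measurable_kineticPP_cubicTail L).2.1.comp hWm
    exact wg_intervalIntegrable_of_bound hab hg.aestronglyMeasurable fun r _ =>
      xu_abs_cubicTail_le_of_speed L (Φ.flow r z) hV0 (hv r)

end Summit.AtomisticToContinuum.HydrodynamicLimit.Theorems.NearConstantShortTimeHL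

end
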